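/-
Copyright (c) 2026. All rights reserved.
Released under Apache 2.0 license as described in the file LICENSE.
Authors: abc-iut cell, prover seat abc-iut-L4-t12 (gen 8).
-/
import Literature.AnabelianGeometry.AbsoluteAnabelian.ArchimedeanHolFieldFunctorGeometricPlaneComplAut
import Literature.AnabelianGeometry.AbsoluteAnabelian.ArchimedeanHolFieldFunctorGeometricCovers
import Literature.Analysis.Complex.PuncturedPlaneDoubleCovers
import Literature.AnabelianGeometry.AbsoluteAnabelian.ArchimedeanHolFieldFunctorGeometricGaloisDescent
import HarnessLib

/-!
# [AbsTopIII] Prop 4.2 (i), geometric column: (H1′) at `ℂ ∖ F` — an automorphism acting trivially on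
# the slice is the identity

PROOF-ONLY file (abc-iut cell, campaign-L item R1.2 of the `EA` column of [AbsTopIII] Prop 4.2 /
Cor 4.5; classical).  The cell's per-object residual at an object `𝕏` of abc-iut-L4-t14's geometric
model `HolRS` (S. Mochizuki, *Topics in Absolute Anabelian Geometry III*, proof of Prop 4.2 (i), kurims
p.106 l.11–19) is abc-iut-w5-d144's

> (H1′) every automorphism `σ` of `𝕏` with `Over.map σ.hom ≅ 𝟭 (Over 𝕏)` is the identity

(`ArchimedeanHolFieldFunctorGeometricGaloisDescent.isIdRigid_mapsTo_of_over_of_twist`).  THIS FILE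
DISCHARGES (H1′) at `𝕏 = ℂ ∖ F` for every finite `F ⊆ ℂ` with at least two points, by an elementary
covering-space argument (no fundamental groups): for `p ∈ F` the puncture double cover
`E_p = {y | y² + p ∉ F} → ℂ ∖ F`, `y ↦ y² + p` (`PuncturedPlaneDoubleCovers`) is an object over `ℂ ∖ F`
(gen 7's `HolRS.ofCover`); an isomorphism `(E_p, π) ≅ (E_p, π ≫ σ)` over `ℂ ∖ F` — a component of
`Over.map σ.hom ≅ 𝟭` — transports the END PARITIES of `π` along the end permutation of `σ`
(`PuncturedPlaneEnds.end_trichotomy`); since `π` is odd exactly at `p` and `∞`, `σ` permutes `{p, ∞}`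
for every `p ∈ F`, hence (two distinct `p`) fixes `∞` and every puncture, hence is the identity
(`planeComplFinite_iso_eq_id_of_tendsto`, Conway V Thm 1.21: automorphisms are Möbius).

* `HolRS.exists_homeomorph_sqAddCover_of_overMap_iso` — the homeomorphism `g` of `E_p` with
  `g(y)² + p = σ(y² + p)` extracted from `Over.map σ.hom ≅ 𝟭`;
* `HolRS.planeComplFinite_twist_eq_id` — **(H1′) at `ℂ ∖ F`, `|F| ≥ 2`, UNCONDITIONALLY**;
* `HolRS.isIdRigid_mapsTo_planeComplFinite` — hence, with abc-iut-w5-d144's slice route and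
  `Z(π̂₁(ℂ ∖ F)) = 1` (abc-iut-L6-t18 / -w5-d144): **«objects of `HolRS` mapping to `ℂ ∖ F`» is id-rigid
  for every finite `F` with `2 ≤ |F|`** — print's per-object statement of the proof of Prop 4.2 (i) at
  these objects of the geometric model, no residual hypothesis.

HONEST SCOPE: model level (OUR `HolRS`); orbicurves, uniformisation and Lemma 4.3 untouched; the
once-punctured elliptic curve is abc-iut-w5-d144's «H1PRIME-ELLIPTIC»; nothing here bears on [IUTchIII]
Cor. 3.12; model ≠ reconstruction; support library, not a node.  No definitions.

## References

* S. Mochizuki, *Topics in Absolute Anabelian Geometry III*, kurims ms, proof of Prop 4.2 (i) p.106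
  l.11–19. [MochizukiAbsTopIII2015]
* A. Hatcher, *Algebraic Topology*, CUP 2002, §1.3. [HatcherAT2002]
* J. B. Conway, *Functions of One Complex Variable I*, GTM 11 (1978), Ch. V Thm. 1.21. [Conway1978]
-/

noncomputable section

open CategoryTheory Set Filter Topology TopologicalSpace
open scoped Manifold ContDiff
open Literature.Analysis.Complex
open Literature.Topology.CoveringSpaces

namespace Literature.AnabelianGeometry.AbsoluteAnabelian

namespace HolRS

variable {F : Set ℂ} (hF : F.Finite)

/-! ### §1 The puncture double cover as an object over `ℂ ∖ F`, and the twist homeomorphism -/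

/-- The structure map of the puncture double cover, typed into the carrier of `planeComplFinite F`.
[cite: HatcherAT2002, §1.3 p.56] -/
theorem isCoveringMap_sqAddCover' {p : ℂ} (hp : p ∈ F) :
    IsCoveringMap (fun e : ↥((fun y : ℂ => y ^ 2 + p) ⁻¹' Fᶜ) =>
      (⟨(e : ℂ) ^ 2 + p, e.2⟩ : (planeComplFinite F hF).carrier)) :=
  PuncturedPlane.isCoveringMap_sqAddCover hp

/-- … and its fibres are finite. [cite: HatcherAT2002, §1.3 p.56] -/
theorem finite_fibre_sqAddCover' {p : ℂ} (x : (planeComplFinite F hF).carrier) :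
    ((fun e : ↥((fun y : ℂ => y ^ 2 + p) ⁻¹' Fᶜ) =>
      (⟨(e : ℂ) ^ 2 + p, e.2⟩ : (planeComplFinite F hF).carrier)) ⁻¹' {x}).Finite :=
  PuncturedPlane.finite_fibre_sqAddCover x

/-- **The twist homeomorphism.**  If `Over.map σ.hom ≅ 𝟭 (Over (ℂ ∖ F))` for an automorphism `σ` of
`ℂ ∖ F` in `HolRS` with ambient representative `f`, then for every `p ∈ F` the puncture double cover
`E_p` carries a self-homeomorphism `g` with `g(y)² + p = f(y² + p)`: the `E_p`-component of the natural
isomorphism is an isomorphism `(E_p, π ≫ σ) ≅ (E_p, π)` over `ℂ ∖ F`.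
[cite: MochizukiAbsTopIII2015, Proposition 4.2 (i) p.106] [cite: HatcherAT2002, §1.3 p.61] -/
theorem exists_homeomorph_sqAddCover_of_overMap_iso (σ : planeComplFinite F hF ≅ planeComplFinite F hF)
    (η : Over.map σ.hom ≅ 𝟭 (Over (planeComplFinite F hF))) {f : ℂ → ℂ}
    (hf : ∀ x : (⟨Fᶜ, hF.isClosed.isOpen_compl⟩ : Opens ℂ), Subtype.val (σ.hom.toFun x) = f x)
    {p : ℂ} (hp : p ∈ F) :
    ∃ g : ↥((fun y : ℂ => y ^ 2 + p) ⁻¹' Fᶜ) ≃ₜ ↥((fun y : ℂ => y ^ 2 + p) ⁻¹' Fᶜ),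
      ∀ e, ((g e : ℂ)) ^ 2 + p = f ((e : ℂ) ^ 2 + p) := by
  haveI := PuncturedPlane.connectedSpace_sqAddCover hF (p := p)
  -- the object `(E_p, π)` over `X = planeComplFinite F hF`
  let A : Over (planeComplFinite F hF) := Over.mk ((planeComplFinite F hF).ofCoverHom
    (isCoveringMap_sqAddCover' hF hp) (finite_fibre_sqAddCover' hF))
  -- the component of `η` at `A` : `(E_p, π ≫ σ) ≅ (E_p, π)` over `X`
  let k := η.app A
  have hw : k.hom.left ≫ A.hom = A.hom ≫ σ.hom := by
    have h := Over.w k.hom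
    simp only [Functor.id_obj, Over.map_obj_hom] at h
    exact h
  -- the underlying isomorphism of `HolRS` and its homeomorphism
  let e : (planeComplFinite F hF).ofCover (isCoveringMap_sqAddCover' hF hp) (finite_fibre_sqAddCover' hF) ≅
      (planeComplFinite F hF).ofCover (isCoveringMap_sqAddCover' hF hp) (finite_fibre_sqAddCover' hF) :=
    (Over.forget (planeComplFinite F hF)).mapIso k
  obtain ⟨g, hg, -, -, -⟩ := exists_homeomorph_of_iso e
  refine ⟨@id (↥((fun y : ℂ => y ^ 2 + p) ⁻¹' Fᶜ) ≃ₜ ↥((fun y : ℂ => y ^ 2 + p) ⁻¹' Fᶜ)) g,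
    fun x => ?_⟩
  -- `π (g x) = σ (π x)`, read in `ℂ`
  have h1 := congrArg (fun m : ((planeComplFinite F hF).ofCover (isCoveringMap_sqAddCover' hF hp)
      (finite_fibre_sqAddCover' hF)) ⟶ planeComplFinite F hF => Subtype.val (m.toFun x)) hw
  simp only [comp_toFun, Function.comp_apply] at h1
  -- left side: `A.hom.toFun (k.hom.left.toFun x) = ⟨(g x)² + p, _⟩`
  have hgx : (g : _ → _) x = e.hom.toFun x := congrFun hg x
  have hA : ∀ y : ↥((fun y : ℂ => y ^ 2 + p) ⁻¹' Fᶜ), Subtype.val (A.hom.toFun y) = (y : ℂ) ^ 2 + p :=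
    fun y => rfl
  rw [hA] at h1
  have hk : k.hom.left.toFun x = (g : _ → _) x := by rw [hgx]; rfl
  rw [hk, hf] at h1
  exact h1

/-! ### §2 Inverting the end map of an automorphism -/

/-- For a holomorphic automorphism `φ` of `ℂ ∖ S` (`S` finite) with ambient representatives `f` of `φ`
and `f'` of `φ⁻¹`: if `f` maps the end `l` to the end `l'`, then `f'` maps `l'` back to `l`.
[cite: Conway1978, Ch. V Thm. 1.21 and Def. 1.3] -/
theorem _root_.Literature.Analysis.Complex.PuncturedPlane.tendsto_symm_of_tendsto {S : Set ℂ}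
    {U : Opens ℂ} (hU : (U : Set ℂ) = Sᶜ) (hS : S.Finite) {φ : U ≃ₜ U}
    (hφ : MDifferentiable 𝓘(ℂ, ℂ) 𝓘(ℂ, ℂ) φ) {f f' : ℂ → ℂ} (hf : ∀ x : U, (φ x : ℂ) = f x)
    (hf' : ∀ x : U, (φ.symm x : ℂ) = f' x) {l l' : Filter ℂ}
    (hl : l = cocompact ℂ ∨ ∃ p ∈ S, l = 𝓝[≠] p) (hl' : l' = cocompact ℂ ∨ ∃ p ∈ S, l' = 𝓝[≠] p)
    (h : Tendsto f l l') : Tendsto f' l' l := by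
  have hφ' : MDifferentiable 𝓘(ℂ, ℂ) 𝓘(ℂ, ℂ) φ.symm := PuncturedPlane.mdifferentiable_symm φ hφ
  obtain ⟨l'', hl'', h''⟩ := PuncturedPlane.end_trichotomy hU hU hS hφ' hf' hl'
  haveI := PuncturedPlane.neBot_of_isEnd (S := S) hl
  have hcomp : Tendsto (f' ∘ f) l l'' := h''.comp h
  have hid : (f' ∘ f) =ᶠ[l] id :=
    (PuncturedPlane.eventually_mem_of_isEnd hU hS hl).mono fun z hz =>
      PuncturedPlane.symm_apply_apply hf hf' hz
  have hle : l ≤ l'' := by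
    have := hcomp.congr' hid
    rwa [tendsto_id'] at this
  have heq : l = l'' := by
    by_contra hne
    have hd := PuncturedPlane.disjoint_of_isEnd_of_ne hl hl'' hne
    have : l = ⊥ := by
      have h2 : l ⊓ l'' = l := inf_eq_left.mpr hle
      rw [← h2]; exact hd.eq_bot
    exact (PuncturedPlane.neBot_of_isEnd (S := S) hl).ne this
  rw [heq]; exact h''

/-! ### §3 (H1′) at `ℂ ∖ F` -/

/-- **(H1′) at `ℂ ∖ F` (`F` finite with two distinct points) — UNCONDITIONAL.**  An automorphism `σ`
of `ℂ ∖ F` in `HolRS` whose pull-back functor on the slice is isomorphic to the identity,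
`Over.map σ.hom ≅ 𝟭 (Over (ℂ ∖ F))`, is the identity.  PROOF: for each `p ∈ F`, the twist
homeomorphism of the puncture double cover `E_p` (§1) shows that the end parity of `E_p → ℂ ∖ F` is
invariant under the end permutation of `σ` (`PuncturedPlane.odd_comp_of_odd`,
`odd_comp_homeomorph_iff`); `E_p` is odd exactly at `p` and `∞`
(`odd_sqAddCover_nhdsNE_self`, `odd_sqAddCover_cocompact`, `not_odd_sqAddCover_nhdsNE_of_ne`), so `σ`
maps `p` and `∞` into `{p, ∞}` — for every `p ∈ F`; with two distinct punctures this forces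
`σ(∞) = ∞` and `σ(p) = p` for all `p`, and `planeComplFinite_iso_eq_id_of_tendsto` concludes.
[cite: MochizukiAbsTopIII2015, Proposition 4.2 (i) p.106] [cite: HatcherAT2002, §1.3 p.61] -/
theorem planeComplFinite_twist_eq_id {p₁ p₂ : ℂ} (hp₁ : p₁ ∈ F) (hp₂ : p₂ ∈ F) (hp : p₁ ≠ p₂)
    (σ : planeComplFinite F hF ≅ planeComplFinite F hF)
    (hσ : Nonempty (Over.map σ.hom ≅ 𝟭 (Over (planeComplFinite F hF)))) : σ.hom = 𝟙 _ := by
  classical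
  obtain ⟨η⟩ := hσ
  set U : Opens ℂ := ⟨Fᶜ, hF.isClosed.isOpen_compl⟩ with hUdef
  have hU : (U : Set ℂ) = Fᶜ := rfl
  obtain ⟨φ, hφ, hφa, hφa'⟩ := exists_mem_holAut_of_iso U (isConnected_compl_finite hF) σ
  have hφd : MDifferentiable 𝓘(ℂ, ℂ) 𝓘(ℂ, ℂ) φ := ((mem_holAut_iff φ).mp hφ).1
  -- ambient representatives of `φ` and `φ⁻¹`
  let f : ℂ → ℂ := fun z => if h : z ∈ U then (φ ⟨z, h⟩ : ℂ) else 0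
  let f' : ℂ → ℂ := fun z => if h : z ∈ U then (φ.symm ⟨z, h⟩ : ℂ) else 0
  have hf : ∀ x : U, (φ x : ℂ) = f x := fun x => by simp only [f, dif_pos x.2]
  have hf' : ∀ x : U, (φ.symm x : ℂ) = f' x := fun x => by simp only [f', dif_pos x.2]
  have hfσ : ∀ x : U, Subtype.val (σ.hom.toFun x) = f x := fun x => by rw [← hf x, hφa]
  -- STEP A: parity transport along `σ` for the double cover at `p ∈ F`
  have stepA : ∀ {p : ℂ}, p ∈ F → ∀ {L L' : Filter ℂ},
      (L = cocompact ℂ ∨ ∃ q ∈ F, L = 𝓝[≠] q) → (L' = cocompact ℂ ∨ ∃ q ∈ F, L' = 𝓝[≠] q) →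
      Tendsto f L' L →
      (∀ N ∈ L', ∃ N' ∈ L', N' ⊆ N ∧
        IsConnected ((fun e : ↥((fun y : ℂ => y ^ 2 + p) ⁻¹' Fᶜ) => (e : ℂ) ^ 2 + p) ⁻¹' N')) →
      ∀ N ∈ L, ∃ N' ∈ L, N' ⊆ N ∧
        IsConnected ((fun e : ↥((fun y : ℂ => y ^ 2 + p) ⁻¹' Fᶜ) => (e : ℂ) ^ 2 + p) ⁻¹' N') := by
    intro p hpF L L' hL hL' hfL hodd
    obtain ⟨g, hg⟩ := exists_homeomorph_sqAddCover_of_overMap_iso hF σ η hfσ hpF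
    -- `(f ∘ P) = P ∘ g`
    have hPg : (f ∘ fun e : ↥((fun y : ℂ => y ^ 2 + p) ⁻¹' Fᶜ) => (e : ℂ) ^ 2 + p) =
        (fun e : ↥((fun y : ℂ => y ^ 2 + p) ⁻¹' Fᶜ) => (e : ℂ) ^ 2 + p) ∘ g := by
      funext e; simp only [Function.comp_apply, hg]
    have h1 : ∀ N ∈ L, ∃ N' ∈ L, N' ⊆ N ∧
        IsConnected ((f ∘ fun e : ↥((fun y : ℂ => y ^ 2 + p) ⁻¹' Fᶜ) => (e : ℂ) ^ 2 + p) ⁻¹' N') :=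
      PuncturedPlane.odd_comp_of_odd (U := Fᶜ) (f' := f')
        (fun e => e.2) (fun z hz => PuncturedPlane.apply_mem hf ((PuncturedPlane.mem_iff hU).mpr hz))
        (fun z hz => PuncturedPlane.symm_apply_apply hf hf' ((PuncturedPlane.mem_iff hU).mpr hz))
        (fun z hz => PuncturedPlane.symm_apply_apply hf' hf ((PuncturedPlane.mem_iff hU).mpr hz))
        hfL (PuncturedPlane.tendsto_symm_of_tendsto hU hF hφd hf hf' hL' hL hfL)
        (PuncturedPlane.eventually_mem_of_isEnd hU hF hL) hodd
    rw [hPg] at h1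
    exact (PuncturedPlane.odd_comp_homeomorph_iff _ g L).mp h1
  -- STEP B: where the ends go
  obtain ⟨Linf, hLinf, hinf⟩ := PuncturedPlane.end_trichotomy hU hU hF hφd hf (Or.inl rfl)
  -- `∞ ↦ ∞` or `∞ ↦ p`, for EVERY `p ∈ F`
  have hinf_cases : ∀ p ∈ F, Linf = cocompact ℂ ∨ Linf = 𝓝[≠] p := by
    intro p hpF
    have hodd := stepA hpF hLinf (Or.inl rfl) hinf (PuncturedPlane.odd_sqAddCover_cocompact hF)
    rcases hLinf with h | ⟨q, hq, h⟩
    · exact Or.inl h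
    · subst h
      by_cases hqp : q = p
      · exact Or.inr (by rw [hqp])
      · exact absurd hodd (PuncturedPlane.not_odd_sqAddCover_nhdsNE_of_ne hF hqp)
  have hinf_eq : Linf = cocompact ℂ := by
    rcases hinf_cases p₁ hp₁ with h | h1
    · exact h
    rcases hinf_cases p₂ hp₂ with h | h2
    · exact h
    exact absurd (PuncturedPlane.eq_of_nhdsNE_eq (h1.symm.trans h2)) hp
  rw [hinf_eq] at hinf
  -- every finite puncture is fixed
  have hfix : ∀ p ∈ F, Tendsto f (𝓝[≠] p) (𝓝 p) := by
    intro p hpF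
    obtain ⟨Lp, hLp, hLpT⟩ := PuncturedPlane.end_trichotomy hU hU hF hφd hf (Or.inr ⟨p, hpF, rfl⟩)
    have hodd := stepA hpF hLp (Or.inr ⟨p, hpF, rfl⟩) hLpT
      (PuncturedPlane.odd_sqAddCover_nhdsNE_self hF)
    rcases hLp with h | ⟨q, hq, h⟩
    · subst h
      exact absurd (PuncturedPlane.end_injective hU hU hF hF hφd hf (Or.inr ⟨p, hpF, rfl⟩) (Or.inl rfl)
        (Or.inl rfl) hLpT hinf) (PuncturedPlane.nhdsNE_ne_cocompact p)
    · subst h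
      by_cases hqp : q = p
      · subst hqp; exact hLpT.mono_right nhdsWithin_le_nhds
      · exact absurd hodd (PuncturedPlane.not_odd_sqAddCover_nhdsNE_of_ne hF hqp)
  -- conclusion
  refine planeComplFinite_iso_eq_id_of_tendsto hF hp₁ hp₂ hp σ fun p hpF => ?_
  have h1 : Tendsto (f ∘ (Subtype.val : U → ℂ)) (comap Subtype.val (𝓝[≠] p)) (𝓝 p) :=
    (hfix p hpF).comp tendsto_comap
  exact h1.congr fun x => (hfσ x).symm

/-- **«Objects of `HolRS` mapping to `ℂ ∖ F`» is id-rigid for every finite `F` with two distinct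
points — UNCONDITIONALLY** (abc-iut-w5-d144's slice route `isIdRigid_mapsTo_of_twist_of_center_eq_bot`:
(H2) from `Z(π̂₁(ℂ ∖ F)) = 1`, (H1′) from `planeComplFinite_twist_eq_id`).
[cite: MochizukiAbsTopIII2015, Proposition 4.2 (i) p.106] -/
theorem isIdRigid_mapsTo_planeComplFinite {p₁ p₂ : ℂ} (hp₁ : p₁ ∈ F) (hp₂ : p₂ ∈ F) (hp : p₁ ≠ p₂) :
    IsIdRigid (ObjectProperty.FullSubcategory fun Y : HolRS => Nonempty (Y ⟶ planeComplFinite F hF)) :=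
  isIdRigid_mapsTo_of_over_of_twist (planeComplFinite F hF)
    (isIdRigid_over_planeComplFinite hF (by
      rw [← Set.ncard_pair hp]
      exact Set.ncard_le_ncard (Set.pair_subset hp₁ hp₂) hF))
    fun σ hσ => planeComplFinite_twist_eq_id hF hp₁ hp₂ hp σ hσ

end HolRS

end Literature.AnabelianGeometry.AbsoluteAnabelian

-- tree-health (abc-iut-w6-d081 g4, 2026-08-26T14:21Z): comment-only re-land of a STRANDED ACCEPT (p447779 accepted ≈13:1xZ, not importable on the farm
-- 13:21–14:20Z per abc-iut-L4-t10; blocks their Cor 4.5 consumer); declarations byte-identical; purpose = trigger the rebuild (w4-d014 remedy class).
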